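import Summits.QuantumFields.BalabanUV.T4Continuum.Support.NE3CovariantLandauKill
import Summits.QuantumFields.BalabanUV.T4Continuum.Support.NE3BlockPoincareLandau
import Summits.QuantumFields.BalabanUV.T4Continuum.Support.AveragingDeficitHSInner
import HarnessLib

/-!
# T⁴ programme, node NE3 — route H♮ (ruling ρ-g22-2), row K4, item K4-d2: THE S-IDENTITY AND THE S-BOUND AT A CURVED BACKGROUND

NE3 (node U1b), row NE3 OWNER `b2b-balaban-t4-ne3-p1` (gen 23), K4 holder; SHAPE K4 (journal l.17848) item K4-d, split by RULING ρ-g23-2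
(l.18808): K4-d1 (the core at W) → leaf-03-g8; **K4-d2 (this file)**.  On K4-a (`NE3CovariantLineAdjoint{,Frame}`: torus adjoint at any
unitary transport family), K4-b (`NE3CovariantLineSplit`: `hspW`, `JmpW`, the split in `cD` form), K4-c (`NE3CovariantBlockDivergence`,
`NE3CovariantLandauKill`: the Landau kill) and the flat (71S) `NE3BlockPoincareLandau` (`sum_comp_cdiv`) BY NAME.

CONTENT (all [folklore]; 0 sorry; 0 def).  `M, N ≥ 1`, unitary `(M·N)`-periodic `W`, `N`-periodic coarse `ω`, `(M·N)`-periodic fine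
`η`, shifted configurations `V_κ y μ := W (y + e_κ) μ`:
§1 `cornerToBond_add_period`, `hspW_add_period`, `JmpW_sub`; §2 **`sum_hsR_TWg_combFrame_eq`** (THE S-IDENTITY, EXACT):
`Σ_zΣ_κ hsR (ω z κ) (TWg M (combFrame W M) η z κ) = Σ_κΣ_x hsR (hspW M W ω x κ) (cDstar V_κ κ (η · κ) x) + Σ_xΣ_κ hsR (JmpW M W ω x κ) (η x κ)`
(K4-a adjoint ∘ K4-b split ∘ `sum_hsR_cD` along each `κ`) and **`sum_hsR_TWg_combFrame_eq_kill`** (ANY unitary `N`-periodic `U`, ANY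
`N`-periodic `ψ`): `JmpW ω = JmpW (ω − D_Uψ) + JmpW (D_Uψ)`, the second killed by K4-c into `−M²·Σ_y hsR (covDiv W η y) (psiExt M W ψ y)
+ M²·Σ_z hsR (ψ z) (combDefect + coarseMismatch − Σ_κ (farDefect + nearDefect))`; §4 nhs tools (`hsR = hsRe`, Cauchy–Schwarz,
`nhsNorm ∘ Ad`), **`abs_sum_hsR_hspW_le`** (`|spline term| ≤ M²·√(M^d·Σ nhsNormSq ω)·√(Σ nhsNormSq D)`), **`abs_sum_hsR_JmpW_le`**
(`|Σ hsR (JmpW E)(η)| ≤ M²·Σ_zΣ_κ nhsNorm (E z κ)·Σ_t nhsNorm (η(far-face bond))`), `nhsNormSq_cDstar_shift` (`= nhsNormSq (covFd W η (x−e_κ) κ κ)`);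
§5 **THE S-BOUND `sum_nhsNormSq_TWg_le`**: `T := TWg M (combFrame W M) η`, `ω := (M^d)⁻¹ • T`,
`Σ_zΣ_κ nhsNormSq (T z κ) ≤ M^{d+4}·Σ_xΣ_κ nhsNormSq (cDstar V_κ κ (η · κ) x) + 2·M^d·R`,
`R := Σ_xΣ_κ hsR (JmpW M W (ω − D_Uψ) x κ) (η x κ) − M²·Σ_y hsR (covDiv W η y) (psiExt M W ψ y) + M²·Σ_z hsR (ψ z) (loops z)` (the quadratic step
`x² ≤ bx + c ⇒ x² ≤ b² + 2c`); `R` stays NAMED for K6's ε-budget.  At `W = U = 1`, `η` Landau, `ψ` exact: `R = 0`, this is (71S) §2 (constant 1).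

HONEST FRAMING.  Exact bookkeeping at a GENERAL unitary background plus Cauchy–Schwarz, on OUR typed objects; nothing about Bałaban's
minimisers; (P♮)_W, (ML_w) at W ≠ 1, T-E_w and NE3 are NOT proved; spine PROVED 0∕9; finite T⁴ rung (B)+1 — NOT infinite volume, NOT mass gap,
NOT BetaPertH, NOT Clay.  ABSOLUTE RULE kept (context only: [Balaban1985Averaging] (122)–(125) p. 36; [Balaban1985PropagatorsII] Thm 3.3 (3.46)).
PLACEMENT: `Summits/QuantumFields/BalabanUV/`; imports accepted modules only.
-/

set_option autoImplicit false

open scoped BigOperators Matrix.Norms.L2Operator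
open Finset

namespace Summit.QuantumFields.BalabanUV.T4Continuum.NE3CovariantSBound

open Literature.MathematicalPhysics.QuantumFieldTheory.Balaban1983to89
open B7Prop1Explicit B7Prop2Explicit MatrixNorms
open T4AveragingDeficitWall (IsUnitaryCfg Ad)
open T4AveragingDeficitWallBoundary (periodBox mem_periodBox IsPeriodicCfg)
open T4AveragingDeficitNonAbelian (Ad_mul Ad_sub hol_add_period)
open AveragingDeficitNearIdentity (Ad_add Ad_real_smul)
open AveragingDeficitHSInner (hsRe hsRe_eq abs_hsRe_le nhsNormSq_Ad nhsNormSq_smul)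
open AveragingDeficitBlockDensity (btree bseg)
open NE3CovariantWeitzenbock (covDiv)
open AveragingDeficitCovGrad (covFd)
open NE3CovariantCalculus (hsR cD cDstar hsR_add_left hsR_sub_left hsR_sum_left hsR_self sum_hsR_cD)
open NE3FrameFreeDecompositionPrep (hsR_smul_left)
open NE3CoarseTorusExact (sum_periodBox_sub_e)
open NE3BlockPoincareLandau (sum_comp_cdiv)
open NE3StraightAverageSplit (αw γw αw_nonneg_le γw_nonneg_le)
open NE3StraightAverageAdjoint (tbase)
open NE3CovariantLineAdjoint (TWg WadWg combFrame cornerToBond hspW JmpW combFrame_mem combFrame_add_period cornerToBond_mem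
  sum_hsR_TWg_eq_sum_hsR_WadWg WadWg_combFrame_eq_cD_add_JmpW)
open NE3CovariantBlockDivergence (combDefect farDefect nearDefect)
open NE3CovariantLandauKill (coarseMismatch psiExt sum_hsR_JmpW_cD_eq)
open SkeletonLattice (cdiv cmod cdiv_add_period cmod_add_period cmod_nonneg cmod_lt)

noncomputable section

variable {d : ℕ} {n : Type*} [Fintype n] [DecidableEq n]

/-! ## §1 Periodicity of the spline objects; additivity of the face jump -/

/-- `cornerToBond` is periodic under a simultaneous shift of the block by `N•e_τ` and of the site by `(M·N)•e_τ`. [folklore] -/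
theorem cornerToBond_add_period {M N : ℕ} {W : Site d → Fin d → (Matrix n n ℂ)ˣ} (hWP : IsPeriodicCfg W ((M * N : ℕ) : ℤ))
    (z x : Site d) (τ κ : Fin d) :
    cornerToBond W M (z + (N : ℤ) • e τ) (x + ((M * N : ℕ) : ℤ) • e τ) κ = cornerToBond W M z x κ := by
  unfold cornerToBond
  have hq : (M : ℤ) • (z + (N : ℤ) • e τ) = (M : ℤ) • z + ((M * N : ℕ) : ℤ) • e τ := by
    rw [smul_add, smul_smul]; push_cast; ring_nf
  have hx : x + ((M * N : ℕ) : ℤ) • e τ - ((M : ℤ) • z + ((M * N : ℕ) : ℤ) • e τ) = x - (M : ℤ) • z := by abel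
  rw [hq, hx, hol_add_period hWP τ]

/-- `hspW` of an `N`-periodic coarse form at an `(M·N)`-periodic background is `(M·N)`-periodic (`M ≥ 1`). [folklore] -/
theorem hspW_add_period {M N : ℕ} (hM : 1 ≤ M) {W : Site d → Fin d → (Matrix n n ℂ)ˣ} (hWP : IsPeriodicCfg W ((M * N : ℕ) : ℤ))
    {ω : Site d → Fin d → Matrix n n ℂ} (hω : ∀ (z : Site d) (τ μ : Fin d), ω (z + (N : ℤ) • e τ) μ = ω z μ)
    (x : Site d) (τ κ : Fin d) : hspW M W ω (x + ((M * N : ℕ) : ℤ) • e τ) κ = hspW M W ω x κ := by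
  unfold hspW
  have hc := cdiv_add_period (L := M) hM (N : ℤ) x τ
  have hm := cmod_add_period (L := M) (N : ℤ) x τ
  have hMN : ((M : ℤ) * (N : ℤ)) = ((M * N : ℕ) : ℤ) := by push_cast; ring
  rw [hMN] at hc hm
  rw [hc, hm, cornerToBond_add_period hWP, hω, show cdiv M x + (N : ℤ) • e τ - e κ = (cdiv M x - e κ) + (N : ℤ) • e τ by abel,
    cornerToBond_add_period hWP, hω]

/-- The face jump is additive in the coarse form: `JmpW (ω₁ − ω₂) = JmpW ω₁ − JmpW ω₂`. [folklore] -/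
theorem JmpW_sub (M : ℕ) (W : Site d → Fin d → (Matrix n n ℂ)ˣ) (ω₁ ω₂ : Site d → Fin d → Matrix n n ℂ) (x : Site d) (κ : Fin d) :
    JmpW M W (fun z μ => ω₁ z μ - ω₂ z μ) x κ = JmpW M W ω₁ x κ - JmpW M W ω₂ x κ := by
  unfold JmpW
  split_ifs
  · rw [Ad_sub, smul_sub]
  · rw [sub_zero]

/-! ## §2 The S-identity at a curved background -/

/-- The shifted configuration `V_κ y μ := W (y + e_κ) μ` is unitary. [folklore] -/
theorem isUnitaryCfg_shift {W : Site d → Fin d → (Matrix n n ℂ)ˣ} (hW : IsUnitaryCfg W) (κ : Fin d) :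
    IsUnitaryCfg (fun y μ => W (y + e κ) μ) := fun y μ => hW (y + e κ) μ

/-- The shifted configuration of a `P`-periodic configuration is `P`-periodic. [folklore] -/
theorem isPeriodicCfg_shift {W : Site d → Fin d → (Matrix n n ℂ)ˣ} {P : ℤ} (hWP : IsPeriodicCfg W P) (κ : Fin d) :
    IsPeriodicCfg (fun y μ => W (y + e κ) μ) P := by
  intro y τ μ
  show W (y + P • e τ + e κ) μ = W (y + e κ) μ
  rw [add_right_comm, hWP]

section Identity

variable {M N : ℕ} {W : Site d → Fin d → (Matrix n n ℂ)ˣ} {ω η : Site d → Fin d → Matrix n n ℂ}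

/-- **THE S-IDENTITY AT W** (EXACT): `Σ_zΣ_κ hsR (ω z κ) (TWg M (combFrame W M) η z κ)
 = Σ_κ Σ_x hsR (hspW M W ω x κ) (cDstar V_κ κ (η · κ) x) + Σ_xΣ_κ hsR (JmpW M W ω x κ) (η x κ)`, `V_κ y μ := W (y + e_κ) μ`
(K4-a adjoint ∘ K4-b split ∘ covariant summation by parts along `κ`).  No smallness, no gauge fixing. [folklore] -/
theorem sum_hsR_TWg_combFrame_eq (hM : 1 ≤ M) (hN : 1 ≤ N) (hW : IsUnitaryCfg W) (hWP : IsPeriodicCfg W ((M * N : ℕ) : ℤ))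
    (hω : ∀ (z : Site d) (τ μ : Fin d), ω (z + (N : ℤ) • e τ) μ = ω z μ)
    (hη : ∀ (x : Site d) (τ μ : Fin d), η (x + ((M * N : ℕ) : ℤ) • e τ) μ = η x μ) :
    ∑ z ∈ periodBox (d := d) N, ∑ κ : Fin d, hsR (ω z κ) (TWg M (combFrame W M) η z κ)
      = ∑ κ : Fin d, ∑ x ∈ periodBox (d := d) (M * N),
            hsR (hspW M W ω x κ) (cDstar (fun y μ => W (y + e κ) μ) κ (fun y => η y κ) x)
        + ∑ x ∈ periodBox (d := d) (M * N), ∑ κ : Fin d, hsR (JmpW M W ω x κ) (η x κ) := by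
  have hMN : 1 ≤ M * N := Nat.one_le_iff_ne_zero.mpr (Nat.mul_ne_zero (by omega) (by omega))
  rw [sum_hsR_TWg_eq_sum_hsR_WadWg hM hN (combFrame W M) (fun z κ v i => combFrame_mem hW M z κ v i)
    (fun z τ κ v i => combFrame_add_period hWP z τ κ v i) ω η hω hη]
  have hsplit : ∀ (x : Site d) (κ : Fin d), hsR (WadWg M (combFrame W M) ω x κ) (η x κ)
      = hsR (cD (fun y μ => W (y + e κ) μ) κ (fun y => hspW M W ω y κ) x) (η x κ) + hsR (JmpW M W ω x κ) (η x κ) := by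
    intro x κ
    rw [WadWg_combFrame_eq_cD_add_JmpW hM, hsR_add_left]
  have hparts : ∀ κ : Fin d, ∑ x ∈ periodBox (d := d) (M * N), hsR (cD (fun y μ => W (y + e κ) μ) κ (fun y => hspW M W ω y κ) x) (η x κ)
      = ∑ x ∈ periodBox (d := d) (M * N), hsR (hspW M W ω x κ) (cDstar (fun y μ => W (y + e κ) μ) κ (fun y => η y κ) x) :=
    fun κ => sum_hsR_cD hMN (isUnitaryCfg_shift hW κ) (isPeriodicCfg_shift hWP κ) κ
      (fun y τ => hspW_add_period hM hWP hω y τ κ) (fun y τ => hη y τ κ)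
  rw [sum_congr rfl fun x _ => sum_congr rfl fun κ _ => hsplit x κ, sum_congr rfl fun x _ => sum_add_distrib,
    sum_add_distrib, sum_comm, sum_congr rfl fun κ _ => hparts κ]

/-- **THE S-IDENTITY WITH A COARSE POTENTIAL** (EXACT; ANY unitary `N`-periodic `U`, ANY `N`-periodic `ψ`): the face jump of
`ω − D_Uψ` stays, the face jump of `D_Uψ` is killed by K4-c:
`Σ_zΣ_κ hsR (ω z κ) (TWg …) = [spline term] + Σ_xΣ_κ hsR (JmpW M W (ω − D_Uψ) x κ) (η x κ)
  − M²·Σ_y hsR (covDiv W η y) (psiExt M W ψ y) + M²·Σ_z hsR (ψ z) (combDefect + coarseMismatch − Σ_κ (farDefect + nearDefect))`.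
[folklore] -/
theorem sum_hsR_TWg_combFrame_eq_kill (hM : 1 ≤ M) (hN : 1 ≤ N) (hW : IsUnitaryCfg W) (hWP : IsPeriodicCfg W ((M * N : ℕ) : ℤ))
    (hω : ∀ (z : Site d) (τ μ : Fin d), ω (z + (N : ℤ) • e τ) μ = ω z μ)
    (hη : ∀ (x : Site d) (τ μ : Fin d), η (x + ((M * N : ℕ) : ℤ) • e τ) μ = η x μ)
    {U : Site d → Fin d → (Matrix n n ℂ)ˣ} (hU : IsUnitaryCfg U) (hUP : IsPeriodicCfg U (N : ℤ))
    {ψ : Site d → Matrix n n ℂ} (hψ : ∀ (z : Site d) (τ : Fin d), ψ (z + (N : ℤ) • e τ) = ψ z) :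
    ∑ z ∈ periodBox (d := d) N, ∑ κ : Fin d, hsR (ω z κ) (TWg M (combFrame W M) η z κ)
      = ∑ κ : Fin d, ∑ x ∈ periodBox (d := d) (M * N),
            hsR (hspW M W ω x κ) (cDstar (fun y μ => W (y + e κ) μ) κ (fun y => η y κ) x)
        + ∑ x ∈ periodBox (d := d) (M * N), ∑ κ : Fin d, hsR (JmpW M W (fun z μ => ω z μ - cD U μ ψ z) x κ) (η x κ)
        - (M : ℝ) ^ 2 * ∑ y ∈ periodBox (d := d) (M * N), hsR (covDiv W η y) (psiExt M W ψ y)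
        + (M : ℝ) ^ 2 * ∑ z ∈ periodBox (d := d) N, hsR (ψ z)
            (combDefect W M η z + coarseMismatch U W M η z - ∑ κ : Fin d, (farDefect W M η z κ + nearDefect W M η z κ)) := by
  rw [sum_hsR_TWg_combFrame_eq hM hN hW hWP hω hη]
  have hj : ∀ (x : Site d) (κ : Fin d), hsR (JmpW M W ω x κ) (η x κ)
      = hsR (JmpW M W (fun z μ => ω z μ - cD U μ ψ z) x κ) (η x κ) + hsR (JmpW M W (fun z μ => cD U μ ψ z) x κ) (η x κ) := by
    intro x κ
    rw [← hsR_add_left, JmpW_sub, sub_add_cancel]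
  rw [sum_congr rfl fun x _ => sum_congr rfl fun κ _ => hj x κ, sum_congr rfl fun x _ => sum_add_distrib, sum_add_distrib,
    sum_hsR_JmpW_cD_eq hM hN hW hWP hU hUP hψ hη]
  ring

end Identity

/-! ## §4 Hilbert–Schmidt currency: Cauchy–Schwarz and the spline pairing bound -/

omit [DecidableEq n] in
/-- The two real Hilbert–Schmidt forms of the tree agree: `hsR = hsRe`. [folklore] -/
theorem hsR_eq_hsRe (X Y : Matrix n n ℂ) : hsR X Y = hsRe X Y := by
  rw [hsRe_eq]; rfl

omit [DecidableEq n] in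
/-- Cauchy–Schwarz in nhs currency: `|hsR X Y| ≤ nhsNorm X · nhsNorm Y`. [folklore] -/
theorem abs_hsR_le_nhsNorm (X Y : Matrix n n ℂ) : |hsR X Y| ≤ nhsNorm X * nhsNorm Y := by
  rw [hsR_eq_hsRe]; exact abs_hsRe_le X Y

/-- `nhsNorm (Ad_u X) = nhsNorm X` for unitary `u`. [folklore] -/
theorem nhsNorm_Ad {u : (Matrix n n ℂ)ˣ} (hu : u ∈ unitaryUnits (Matrix n n ℂ)) (X : Matrix n n ℂ) :
    nhsNorm (Ad u X) = nhsNorm X := by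
  unfold nhsNorm; rw [nhsNormSq_Ad hu]

/-- **TERMWISE SPLINE PAIRING BOUND** (unitary `W`, `M ≥ 1`): `|hsR (hspW M W ω x κ) D| ≤ (M²∕2)·(nhsNorm (ω z κ) + nhsNorm (ω (z−e_κ) κ))·nhsNorm D`,
`z = cdiv M x` (linearity of `hsR`, isometric transports, spline weights `≤ M²∕2`). [folklore] -/
theorem abs_hsR_hspW_le {M : ℕ} (hM : 1 ≤ M) {W : Site d → Fin d → (Matrix n n ℂ)ˣ} (hW : IsUnitaryCfg W)
    (ω : Site d → Fin d → Matrix n n ℂ) (x : Site d) (κ : Fin d) (D : Matrix n n ℂ) :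
    |hsR (hspW M W ω x κ) D| ≤ (M : ℝ) ^ 2 / 2 * ((nhsNorm (ω (cdiv M x) κ) + nhsNorm (ω (cdiv M x - e κ) κ)) * nhsNorm D) := by
  have h0 : (0 : ℝ) ≤ ((cmod M x κ : ℤ) : ℝ) := by exact_mod_cast cmod_nonneg (L := M) hM x κ
  have h1 : ((cmod M x κ : ℤ) : ℝ) ≤ (M : ℝ) - 1 := by
    have := cmod_lt (L := M) hM x κ
    have : (cmod M x κ : ℤ) ≤ (M : ℤ) - 1 := by omega
    exact_mod_cast this
  obtain ⟨ha0, ha⟩ := αw_nonneg_le (M := M) h0 h1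
  obtain ⟨hg0, hg⟩ := γw_nonneg_le (M := M) h0 h1
  unfold hspW
  rw [hsR_sub_left, hsR_smul_left, hsR_smul_left]
  have hA := abs_hsR_le_nhsNorm (Ad (cornerToBond W M (cdiv M x) x κ) (ω (cdiv M x) κ)) D
  have hB := abs_hsR_le_nhsNorm (Ad (cornerToBond W M (cdiv M x - e κ) x κ) (ω (cdiv M x - e κ) κ)) D
  rw [nhsNorm_Ad (cornerToBond_mem hW M _ x κ)] at hA hB
  have hD := nhsNorm_nonneg D
  have hωz := nhsNorm_nonneg (ω (cdiv M x) κ)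
  have hωz' := nhsNorm_nonneg (ω (cdiv M x - e κ) κ)
  rw [abs_le] at hA hB ⊢
  constructor <;> nlinarith [hA.1, hA.2, hB.1, hB.2, mul_nonneg hωz hD, mul_nonneg hωz' hD]

/-- **THE SPLINE PAIRING BOUND ON THE TORUS** (unitary `W`, `M, N ≥ 1`, any coarse `ω`, any `D`):
`|Σ_κΣ_{x∈periodBox(M·N)} hsR (hspW M W ω x κ) (D x κ)| ≤ M²·√(M^d·Σ_{z∈periodBox N}Σ_κ nhsNormSq (ω z κ))·√(Σ_xΣ_κ nhsNormSq (D x κ))`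
for `N`-periodic `ω` (the value count: every coarse value is read on `M^d` fine bonds, twice). [folklore] -/
theorem abs_sum_hsR_hspW_le {M N : ℕ} (hM : 1 ≤ M) (hN : 1 ≤ N) {W : Site d → Fin d → (Matrix n n ℂ)ˣ} (hW : IsUnitaryCfg W)
    {ω : Site d → Fin d → Matrix n n ℂ} (hω : ∀ (z : Site d) (τ μ : Fin d), ω (z + (N : ℤ) • e τ) μ = ω z μ)
    (D : Site d → Fin d → Matrix n n ℂ) :
    |∑ κ : Fin d, ∑ x ∈ periodBox (d := d) (M * N), hsR (hspW M W ω x κ) (D x κ)|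
      ≤ (M : ℝ) ^ 2 * (Real.sqrt ((M : ℝ) ^ d * ∑ z ∈ periodBox (d := d) N, ∑ κ : Fin d, nhsNormSq (ω z κ))
          * Real.sqrt (∑ x ∈ periodBox (d := d) (M * N), ∑ κ : Fin d, nhsNormSq (D x κ))) := by
  set P : ℝ := ∑ κ : Fin d, ∑ x ∈ periodBox (d := d) (M * N),
    (nhsNorm (ω (cdiv M x) κ) + nhsNorm (ω (cdiv M x - e κ) κ)) * nhsNorm (D x κ) with hP
  have hterm : |∑ κ : Fin d, ∑ x ∈ periodBox (d := d) (M * N), hsR (hspW M W ω x κ) (D x κ)| ≤ (M : ℝ) ^ 2 / 2 * P := by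
    rw [hP, mul_sum]
    refine (abs_sum_le_sum_abs _ _).trans (sum_le_sum fun κ _ => ?_)
    rw [mul_sum]
    exact (abs_sum_le_sum_abs _ _).trans (sum_le_sum fun x _ => abs_hsR_hspW_le hM hW ω x κ (D x κ))
  have hCS : P ^ 2 ≤ (∑ κ : Fin d, ∑ x ∈ periodBox (d := d) (M * N), (nhsNorm (ω (cdiv M x) κ) + nhsNorm (ω (cdiv M x - e κ) κ)) ^ 2)
      * ∑ κ : Fin d, ∑ x ∈ periodBox (d := d) (M * N), nhsNorm (D x κ) ^ 2 := by
    rw [hP, ← Finset.sum_product' (f := fun κ x => (nhsNorm (ω (cdiv M x) κ) + nhsNorm (ω (cdiv M x - e κ) κ)) * nhsNorm (D x κ)),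
      ← Finset.sum_product' (f := fun κ x => (nhsNorm (ω (cdiv M x) κ) + nhsNorm (ω (cdiv M x - e κ) κ)) ^ 2),
      ← Finset.sum_product' (f := fun κ x => nhsNorm (D x κ) ^ 2)]
    exact Finset.sum_mul_sq_le_sq_mul_sq _ _ _
  have hω' : ∀ (z : Site d) (τ : Fin d) (κ : Fin d), nhsNormSq (ω (z + (N : ℤ) • e τ - e κ) κ) = nhsNormSq (ω (z - e κ) κ) := by
    intro z τ κ; rw [add_sub_right_comm, hω]
  have hQ : ∑ κ : Fin d, ∑ x ∈ periodBox (d := d) (M * N), (nhsNorm (ω (cdiv M x) κ) + nhsNorm (ω (cdiv M x - e κ) κ)) ^ 2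
      ≤ 4 * ((M : ℝ) ^ d * ∑ z ∈ periodBox (d := d) N, ∑ κ : Fin d, nhsNormSq (ω z κ)) := by
    have hpt : ∀ (κ : Fin d) (x : Site d), (nhsNorm (ω (cdiv M x) κ) + nhsNorm (ω (cdiv M x - e κ) κ)) ^ 2
        ≤ 2 * nhsNormSq (ω (cdiv M x) κ) + 2 * nhsNormSq (ω (cdiv M x - e κ) κ) := by
      intro κ x
      rw [← nhsNorm_sq, ← nhsNorm_sq]
      nlinarith [sq_nonneg (nhsNorm (ω (cdiv M x) κ) - nhsNorm (ω (cdiv M x - e κ) κ))]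
    calc ∑ κ : Fin d, ∑ x ∈ periodBox (d := d) (M * N), (nhsNorm (ω (cdiv M x) κ) + nhsNorm (ω (cdiv M x - e κ) κ)) ^ 2
        ≤ ∑ κ : Fin d, ∑ x ∈ periodBox (d := d) (M * N), (2 * nhsNormSq (ω (cdiv M x) κ) + 2 * nhsNormSq (ω (cdiv M x - e κ) κ)) :=
          sum_le_sum fun κ _ => sum_le_sum fun x _ => hpt κ x
      _ = ∑ κ : Fin d, (2 * ((M : ℝ) ^ d * ∑ z ∈ periodBox (d := d) N, nhsNormSq (ω z κ))
            + 2 * ((M : ℝ) ^ d * ∑ z ∈ periodBox (d := d) N, nhsNormSq (ω (z - e κ) κ))) := by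
          refine sum_congr rfl fun κ _ => ?_
          rw [sum_add_distrib, ← mul_sum, ← mul_sum, sum_comp_cdiv hM N (fun z => nhsNormSq (ω z κ)),
            sum_comp_cdiv hM N (fun z => nhsNormSq (ω (z - e κ) κ))]
      _ = ∑ κ : Fin d, 4 * ((M : ℝ) ^ d * ∑ z ∈ periodBox (d := d) N, nhsNormSq (ω z κ)) := by
          refine sum_congr rfl fun κ _ => ?_
          rw [sum_periodBox_sub_e hN (g := fun z => nhsNormSq (ω z κ)) (fun z τ => by simp only [hω]) κ]
          ring
      _ = 4 * ((M : ℝ) ^ d * ∑ κ : Fin d, ∑ z ∈ periodBox (d := d) N, nhsNormSq (ω z κ)) := by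
          rw [← mul_sum, ← mul_sum]
      _ = 4 * ((M : ℝ) ^ d * ∑ z ∈ periodBox (d := d) N, ∑ κ : Fin d, nhsNormSq (ω z κ)) := by
          rw [sum_comm]
  have hDsq : ∑ κ : Fin d, ∑ x ∈ periodBox (d := d) (M * N), nhsNorm (D x κ) ^ 2
      = ∑ x ∈ periodBox (d := d) (M * N), ∑ κ : Fin d, nhsNormSq (D x κ) := by
    rw [sum_comm]; simp only [nhsNorm_sq]
  set Ω : ℝ := (M : ℝ) ^ d * ∑ z ∈ periodBox (d := d) N, ∑ κ : Fin d, nhsNormSq (ω z κ) with hΩ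
  set G : ℝ := ∑ x ∈ periodBox (d := d) (M * N), ∑ κ : Fin d, nhsNormSq (D x κ) with hG
  have hΩ0 : 0 ≤ Ω :=
    mul_nonneg (by positivity) (sum_nonneg fun _ _ => sum_nonneg fun _ _ => nhsNormSq_nonneg _)
  have hG0 : 0 ≤ G := sum_nonneg fun _ _ => sum_nonneg fun _ _ => nhsNormSq_nonneg _
  have hP0 : 0 ≤ P := sum_nonneg fun _ _ => sum_nonneg fun _ _ =>
    mul_nonneg (add_nonneg (nhsNorm_nonneg _) (nhsNorm_nonneg _)) (nhsNorm_nonneg _)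
  have hP2 : P ^ 2 ≤ (4 * Ω) * G := by rw [hDsq] at hCS; exact hCS.trans (by nlinarith [hQ])
  have hPle : P ≤ 2 * (Real.sqrt Ω * Real.sqrt G) := by
    have h := Real.sqrt_le_sqrt hP2
    rw [Real.sqrt_sq hP0, Real.sqrt_mul (by positivity), Real.sqrt_mul' _ hΩ0,
      show Real.sqrt 4 = 2 by rw [show (4:ℝ) = 2 ^ 2 by norm_num, Real.sqrt_sq (by norm_num)]] at h
    linarith
  calc _ ≤ (M : ℝ) ^ 2 / 2 * P := hterm
    _ ≤ (M : ℝ) ^ 2 / 2 * (2 * (Real.sqrt Ω * Real.sqrt G)) := by gcongr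
    _ = (M : ℝ) ^ 2 * (Real.sqrt Ω * Real.sqrt G) := by ring

/-- **THE FACE-JUMP PAIRING BOUND** (unitary `W`, `M ≥ 1`, any coarse `E`, any fine `η`; K4-c file 2 `sum_hsR_JmpW_eq` + termwise
Cauchy–Schwarz): `|Σ_xΣ_κ hsR (JmpW M W E x κ) (η x κ)| ≤ M²·Σ_{z∈periodBox N}Σ_κ nhsNorm (E z κ)·Σ_t nhsNorm (η (M•z + t + (M−1)e_κ) κ)` —
the face jump of the non-exact part `E = ω − D_Uψ` pairs only with the far-face bond values, in `ℓ¹(faces)`. [folklore] -/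
theorem abs_sum_hsR_JmpW_le {M : ℕ} (hM : 1 ≤ M) (N : ℕ) {W : Site d → Fin d → (Matrix n n ℂ)ˣ} (hW : IsUnitaryCfg W)
    (E η : Site d → Fin d → Matrix n n ℂ) :
    |∑ x ∈ periodBox (d := d) (M * N), ∑ κ : Fin d, hsR (JmpW M W E x κ) (η x κ)|
      ≤ (M : ℝ) ^ 2 * ∑ z ∈ periodBox (d := d) N, ∑ κ : Fin d, nhsNorm (E z κ) *
          ∑ r' : {j : Fin d // j ≠ κ} → Fin M, nhsNorm (η ((M : ℤ) • z + tbase κ r' + ((M : ℤ) - 1) • e κ) κ) := by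
  rw [NE3CovariantLandauKill.sum_hsR_JmpW_eq hM N hW, abs_mul, abs_of_nonneg (by positivity : (0 : ℝ) ≤ (M : ℝ) ^ 2)]
  refine mul_le_mul_of_nonneg_left ?_ (by positivity)
  refine (abs_sum_le_sum_abs _ _).trans (sum_le_sum fun z _ => ?_)
  refine (abs_sum_le_sum_abs _ _).trans (sum_le_sum fun κ _ => ?_)
  rw [NE3CovariantBlockDivergence.farFlux, NE3CovariantCalculus.hsR_sum_right, mul_sum]
  refine (abs_sum_le_sum_abs _ _).trans (sum_le_sum fun r' _ => ?_)
  refine (abs_hsR_le_nhsNorm _ _).trans (le_of_eq ?_)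
  rw [nhsNorm_Ad (hol_mem_of hW _ _)]

/-- The `cDstar` of the shifted configuration is the diagonal covariant difference: `nhsNormSq (cDstar V_κ κ (η · κ) x) = nhsNormSq (covFd W η (x − e_κ) κ κ)`
(unitary `W`). [folklore] -/
theorem nhsNormSq_cDstar_shift {W : Site d → Fin d → (Matrix n n ℂ)ˣ} (hW : IsUnitaryCfg W) (η : Site d → Fin d → Matrix n n ℂ)
    (x : Site d) (κ : Fin d) :
    nhsNormSq (cDstar (fun y μ => W (y + e κ) μ) κ (fun y => η y κ) x) = nhsNormSq (covFd W η (x - e κ) κ κ) := by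
  show nhsNormSq (Ad (W (x - e κ + e κ) κ)⁻¹ (η (x - e κ) κ) - η x κ)
    = nhsNormSq (Ad (W (x - e κ) κ * W (x - e κ + e κ) κ) (η (x - e κ + e κ) κ) - Ad (W (x - e κ) κ) (η (x - e κ) κ))
  simp only [sub_add_cancel]
  rw [Ad_mul, ← Ad_sub, nhsNormSq_Ad (hW _ κ)]
  have h : Ad (W x κ)⁻¹ (η (x - e κ) κ) - η x κ = -(Ad (W x κ)⁻¹ (Ad (W x κ) (η x κ) - η (x - e κ) κ)) := by
    rw [Ad_sub, ← Ad_mul, inv_mul_cancel, AveragingDeficitNearIdentity.Ad_one]; abel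
  rw [h, NE3CovariantCalculus.nhsNormSq_neg, nhsNormSq_Ad ((unitaryUnits _).inv_mem (hW x κ))]

/-! ## §5 The S-bound at a curved background -/

omit [DecidableEq n] in
/-- `hsR ((t:ℝ) • X) X = t · nhsNormSq X`. [folklore] -/
theorem hsR_smul_self (t : ℝ) (X : Matrix n n ℂ) : hsR (t • X) X = t * nhsNormSq X := by
  rw [hsR_smul_left, hsR_self]

/-- **THE S-BOUND AT W**: for `M, N ≥ 1`, unitary `(M·N)`-periodic `W`, `(M·N)`-periodic `η`, ANY unitary `N`-periodic `U` and
`N`-periodic `ψ`, with `T := TWg M (combFrame W M) η` and `ω := (M^d)⁻¹ • T`: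
`Σ_zΣ_κ nhsNormSq (T z κ) ≤ M^{d+4}·Σ_xΣ_κ nhsNormSq (cDstar V_κ κ (η · κ) x) + 2·M^d·R`,
`R = Σ_xΣ_κ hsR (JmpW M W (ω − D_Uψ) x κ) (η x κ) − M²·Σ_y hsR (covDiv W η y) (psiExt M W ψ y) + M²·Σ_z hsR (ψ z) (loops z)`.
[folklore] -/
theorem sum_nhsNormSq_TWg_le {M N : ℕ} (hM : 1 ≤ M) (hN : 1 ≤ N) {W : Site d → Fin d → (Matrix n n ℂ)ˣ} (hW : IsUnitaryCfg W)
    (hWP : IsPeriodicCfg W ((M * N : ℕ) : ℤ)) {η : Site d → Fin d → Matrix n n ℂ}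
    (hη : ∀ (x : Site d) (τ μ : Fin d), η (x + ((M * N : ℕ) : ℤ) • e τ) μ = η x μ)
    {U : Site d → Fin d → (Matrix n n ℂ)ˣ} (hU : IsUnitaryCfg U) (hUP : IsPeriodicCfg U (N : ℤ))
    {ψ : Site d → Matrix n n ℂ} (hψ : ∀ (z : Site d) (τ : Fin d), ψ (z + (N : ℤ) • e τ) = ψ z) :
    ∑ z ∈ periodBox (d := d) N, ∑ κ : Fin d, nhsNormSq (TWg M (combFrame W M) η z κ)
      ≤ (M : ℝ) ^ (d + 4) * ∑ x ∈ periodBox (d := d) (M * N), ∑ κ : Fin d,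
            nhsNormSq (cDstar (fun y μ => W (y + e κ) μ) κ (fun y => η y κ) x)
        + 2 * (M : ℝ) ^ d *
          (∑ x ∈ periodBox (d := d) (M * N), ∑ κ : Fin d,
              hsR (JmpW M W (fun z μ => (((M : ℝ) ^ d)⁻¹ • TWg M (combFrame W M) η z μ) - cD U μ ψ z) x κ) (η x κ)
            - (M : ℝ) ^ 2 * ∑ y ∈ periodBox (d := d) (M * N), hsR (covDiv W η y) (psiExt M W ψ y)
            + (M : ℝ) ^ 2 * ∑ z ∈ periodBox (d := d) N, hsR (ψ z)
                (combDefect W M η z + coarseMismatch U W M η z - ∑ κ : Fin d, (farDefect W M η z κ + nearDefect W M η z κ))) := by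
  set T : Site d → Fin d → Matrix n n ℂ := fun z κ => TWg M (combFrame W M) η z κ with hT
  set ω : Site d → Fin d → Matrix n n ℂ := fun z κ => ((M : ℝ) ^ d)⁻¹ • T z κ with hωdef
  have hMd : (0 : ℝ) < (M : ℝ) ^ d := by positivity
  have hTper : ∀ (z : Site d) (τ κ : Fin d), T (z + (N : ℤ) • e τ) κ = T z κ := by
    intro z τ κ
    simp only [hT, TWg]
    refine sum_congr rfl fun v _ => sum_congr rfl fun i _ => ?_
    rw [combFrame_add_period hWP]
    congr 1
    rw [show (M : ℤ) • (z + (N : ℤ) • e τ) + v + (i : ℤ) • e κ = ((M : ℤ) • z + v + (i : ℤ) • e κ) + ((M * N : ℕ) : ℤ) • e τ by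
      rw [smul_add, smul_smul]; push_cast; abel, hη]
  have hωper : ∀ (z : Site d) (τ μ : Fin d), ω (z + (N : ℤ) • e τ) μ = ω z μ := by
    intro z τ μ; simp only [hωdef, hTper]
  have hid := sum_hsR_TWg_combFrame_eq_kill (ω := ω) hM hN hW hWP hωper hη hU hUP hψ
  set A : ℝ := ∑ z ∈ periodBox (d := d) N, ∑ κ : Fin d, nhsNormSq (T z κ) with hA
  have hL : ∑ z ∈ periodBox (d := d) N, ∑ κ : Fin d, hsR (ω z κ) (TWg M (combFrame W M) η z κ) = ((M : ℝ) ^ d)⁻¹ * A := by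
    rw [hA, mul_sum]
    refine sum_congr rfl fun z _ => ?_
    rw [mul_sum]
    refine sum_congr rfl fun κ _ => ?_
    simp only [hωdef, hT, hsR_smul_self]
  set G : ℝ := ∑ x ∈ periodBox (d := d) (M * N), ∑ κ : Fin d,
    nhsNormSq (cDstar (fun y μ => W (y + e κ) μ) κ (fun y => η y κ) x) with hG
  have hP := abs_sum_hsR_hspW_le hM hN hW hωper (fun x κ => cDstar (fun y μ => W (y + e κ) μ) κ (fun y => η y κ) x)
  have hΩ : (M : ℝ) ^ d * ∑ z ∈ periodBox (d := d) N, ∑ κ : Fin d, nhsNormSq (ω z κ) = ((M : ℝ) ^ d)⁻¹ * A := by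
    rw [hA, mul_sum, mul_sum]
    refine sum_congr rfl fun z _ => ?_
    rw [mul_sum, mul_sum]
    refine sum_congr rfl fun κ _ => ?_
    simp only [hωdef, nhsNormSq_smul]
    field_simp
  rw [hΩ] at hP
  set R : ℝ := ∑ x ∈ periodBox (d := d) (M * N), ∑ κ : Fin d,
        hsR (JmpW M W (fun z μ => ω z μ - cD U μ ψ z) x κ) (η x κ)
      - (M : ℝ) ^ 2 * ∑ y ∈ periodBox (d := d) (M * N), hsR (covDiv W η y) (psiExt M W ψ y)
      + (M : ℝ) ^ 2 * ∑ z ∈ periodBox (d := d) N, hsR (ψ z)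
          (combDefect W M η z + coarseMismatch U W M η z - ∑ κ : Fin d, (farDefect W M η z κ + nearDefect W M η z κ)) with hR
  have hmain : ((M : ℝ) ^ d)⁻¹ * A ≤ (M : ℝ) ^ 2 * (Real.sqrt (((M : ℝ) ^ d)⁻¹ * A) * Real.sqrt G) + R := by
    have h1 : ((M : ℝ) ^ d)⁻¹ * A = (∑ κ : Fin d, ∑ x ∈ periodBox (d := d) (M * N),
        hsR (hspW M W ω x κ) (cDstar (fun y μ => W (y + e κ) μ) κ (fun y => η y κ) x)) + R := by
      rw [← hL, hid, hR]; ring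
    have h2 := (le_abs_self _).trans hP
    calc ((M : ℝ) ^ d)⁻¹ * A = (∑ κ : Fin d, ∑ x ∈ periodBox (d := d) (M * N),
        hsR (hspW M W ω x κ) (cDstar (fun y μ => W (y + e κ) μ) κ (fun y => η y κ) x)) + R := h1
      _ ≤ (M : ℝ) ^ 2 * (Real.sqrt (((M : ℝ) ^ d)⁻¹ * A) * Real.sqrt G) + R := by linarith
  have hA0 : 0 ≤ A := sum_nonneg fun _ _ => sum_nonneg fun _ _ => nhsNormSq_nonneg _
  have hG0 : 0 ≤ G := sum_nonneg fun _ _ => sum_nonneg fun _ _ => nhsNormSq_nonneg _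
  have hsqA : Real.sqrt (((M : ℝ) ^ d)⁻¹ * A) = Real.sqrt (((M : ℝ) ^ d)⁻¹) * Real.sqrt A := Real.sqrt_mul (by positivity) A
  have hx : Real.sqrt A ^ 2 ≤ ((M : ℝ) ^ d * ((M : ℝ) ^ 2 * Real.sqrt (((M : ℝ) ^ d)⁻¹) * Real.sqrt G)) * Real.sqrt A
      + (M : ℝ) ^ d * R := by
    rw [Real.sq_sqrt hA0]
    have h := mul_le_mul_of_nonneg_left hmain hMd.le
    rw [← mul_assoc, mul_inv_cancel₀ hMd.ne', one_mul, hsqA] at h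
    exact h.trans (le_of_eq (by ring))
  -- the quadratic step `x² ≤ bx + c ⇒ x² ≤ b² + 2c`, `x = √A`
  have hq : Real.sqrt A ^ 2 ≤ ((M : ℝ) ^ d * ((M : ℝ) ^ 2 * Real.sqrt (((M : ℝ) ^ d)⁻¹) * Real.sqrt G)) ^ 2
      + 2 * ((M : ℝ) ^ d * R) := by
    nlinarith [hx, sq_nonneg (Real.sqrt A - (M : ℝ) ^ d * ((M : ℝ) ^ 2 * Real.sqrt (((M : ℝ) ^ d)⁻¹) * Real.sqrt G))]
  rw [Real.sq_sqrt hA0] at hq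
  have hb : ((M : ℝ) ^ d * ((M : ℝ) ^ 2 * Real.sqrt (((M : ℝ) ^ d)⁻¹) * Real.sqrt G)) ^ 2 = (M : ℝ) ^ (d + 4) * G := by
    rw [mul_pow, mul_pow, mul_pow, Real.sq_sqrt hG0, Real.sq_sqrt (by positivity), pow_add]
    field_simp
  rw [hb] at hq
  exact hq.trans (le_of_eq (by ring))

end

end Summit.QuantumFields.BalabanUV.T4Continuum.NE3CovariantSBound
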